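import Literature.Algebra.Homology.LefschetzNumberShortExact
import Literature.Algebra.Homology.EulerCharacteristicSingleBiprod
import HarnessLib

/-!
# Lefschetz numbers of `single` complexes and of binary biproducts

Layer `Literature/Algebra/Homology` (pure linear algebra over Mathlib; proved theorems only, 0 definitions, 0 named facts,
no instances, no notation). The TRACE twin of row `EulerCharacteristicSingleBiprod` for row `LefschetzNumber`'s
`lefschetzNumber`, for complexes of vector spaces over a field `K` of ANY shape `c` with `ComplexShape.EulerCharSigns`:

* `moduleFinite_single_obj_X`, **`lefschetzNumber_single_map : Λ((single K c n).map f) = χ(n) • tr f`** for an endomorphism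
  `f : V ⟶ V` of a finite-dimensional space (Hopf on the one-term complex; `((single).map f)ₙ` is conjugate to `f` by
  Mathlib's `singleObjXSelf`, `HomologicalComplex.single_map_f_self`);
* **`lefschetzNumber_biprod_map : Λ(biprod.map φ ψ) = Λ(φ) + Λ(ψ)`** for endomorphisms `φ : C ⟶ C`, `ψ : D ⟶ D` of
  degreewise finite-dimensional finitely supported complexes — row `LefschetzNumberShortExact`'s `lefschetzNumber_X₂_eq_add`
  BY NAME on row `EulerCharacteristicSingleBiprod`'s split sequence `shortExact_biprod` (`C ⟶ C ⊞ D ⟶ D`) carrying the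
  endomorphism `(φ, biprod.map φ ψ, ψ)` (`biprod.inl_map`, `biprod.map_snd`); chain-level form
  `finsum_χ_smul_trace_biprod_map_f`.

`Λ(0)` and acyclic complexes are row `LefschetzNumber` (`lefschetzNumber_zero`, `_eq_zero_of_exactAt`); `φ = ψ = 𝟙`, `f = 𝟙`
are row `EulerCharacteristicSingleBiprod` (`tr 𝟙 = dim`); none restated.
Library only (cell `pub-hodge-ring2`, count-neutral); proves nothing about any crux, route or conjecture.

## References

* A. Hatcher, *Algebraic Topology* (2002), §2.C (Lefschetz number; Thm. 2C.3). [HatcherAT2002]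
* E. H. Spanier, *Algebraic Topology* (1981), Ch. 4 §7 (additivity of traces). [Spanier1981]
-/

open CategoryTheory CategoryTheory.Limits

universe v u w

namespace Literature.Algebra.Homology.Lefschetz

variable {K : Type u} [Field K] {ι : Type w} {c : ComplexShape ι} [c.EulerCharSigns]

/-! ### `single` complexes -/

section Single

variable [DecidableEq ι] (V : ModuleCat.{v} K) (n : ι)

omit [c.EulerCharSigns] in
/-- The terms of `(single n).obj V` are finite-dimensional when `V` is (`V` in degree `n`, `0` elsewhere).
[cite: HatcherAT2002, §2.C] -/
theorem moduleFinite_single_obj_X [Module.Finite K V] (i : ι) :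
    Module.Finite K (((HomologicalComplex.single (ModuleCat.{v} K) c n).obj V).X i) := by
  by_cases h : i = n
  · subst h
    exact Module.Finite.equiv (HomologicalComplex.singleObjXSelf c i V).toLinearEquiv.symm
  · haveI := ModuleCat.subsingleton_of_isZero (HomologicalComplex.isZero_single_obj_X c n V i h)
    infer_instance

/-- **`Λ((single n).map f) = χ(n) • tr f`** for an endomorphism `f` of a finite-dimensional space `V`.
[cite: HatcherAT2002, §2.C] -/
theorem lefschetzNumber_single_map [Module.Finite K V] (f : V ⟶ V) :
    lefschetzNumber ((HomologicalComplex.single (ModuleCat.{v} K) c n).map f) = (c.χ n : ℤ) • LinearMap.trace K V f.hom := by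
  haveI := moduleFinite_single_obj_X (c := c) V n
  rw [lefschetzNumber_eq_sum_χ_smul_trace_f _ {n} (EulerCharSingleBiprod.finrankSupport_single_subset V n),
    Finset.sum_singleton, HomologicalComplex.single_map_f_self, ModuleCat.hom_comp, ModuleCat.hom_comp,
    ← LinearMap.trace_conj' f.hom (HomologicalComplex.singleObjXSelf c n V).toLinearEquiv.symm]
  rfl

end Single

/-! ### Binary biproducts -/

section Biprod

variable {C D : HomologicalComplex (ModuleCat.{v} K) c} (φ : C ⟶ C) (ψ : D ⟶ D)

/-- **`Λ(φ ⊞ ψ) = Λ(φ) + Λ(ψ)`** for endomorphisms of degreewise finite-dimensional complexes with finitely many non-zero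
terms (additivity along the split sequence `C ⟶ C ⊞ D ⟶ D`). [cite: HatcherAT2002, §2.C] [cite: Spanier1981, Ch. 4 §7] -/
theorem lefschetzNumber_biprod_map [∀ i, Module.Finite K (C.X i)] [∀ i, Module.Finite K (D.X i)]
    (hC : (GradedObject.finrankSupport C.X).Finite) (hD : (GradedObject.finrankSupport D.X).Finite) :
    lefschetzNumber (biprod.map φ ψ) = lefschetzNumber φ + lefschetzNumber ψ := by
  have h := lefschetzNumber_X₂_eq_add (EulerCharSingleBiprod.shortExact_biprod C D)
    (ShortComplex.homMk φ (biprod.map φ ψ) ψ (biprod.inl_map φ ψ).symm (biprod.map_snd φ ψ)) hC hD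
  exact h

/-- **Chain level**: `Σᶠ i, χ(i) • tr((φ ⊞ ψ)ᵢ) = Σᶠ i, χ(i) • tr(φᵢ) + Σᶠ i, χ(i) • tr(ψᵢ)`.
[cite: HatcherAT2002, Thm. 2C.3] [cite: Spanier1981, Ch. 4 §7] -/
theorem finsum_χ_smul_trace_biprod_map_f [∀ i, Module.Finite K (C.X i)] [∀ i, Module.Finite K (D.X i)]
    (hC : (GradedObject.finrankSupport C.X).Finite) (hD : (GradedObject.finrankSupport D.X).Finite) :
    ∑ᶠ i, (c.χ i : ℤ) • LinearMap.trace K ((C ⊞ D).X i) ((biprod.map φ ψ).f i).hom =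
      ∑ᶠ i, (c.χ i : ℤ) • LinearMap.trace K (C.X i) (φ.f i).hom +
        ∑ᶠ i, (c.χ i : ℤ) • LinearMap.trace K (D.X i) (ψ.f i).hom := by
  have h := finsum_χ_smul_trace_f_X₂_eq_add (EulerCharSingleBiprod.shortExact_biprod C D)
    (ShortComplex.homMk φ (biprod.map φ ψ) ψ (biprod.inl_map φ ψ).symm (biprod.map_snd φ ψ)) hC hD
  exact h

/-- `Λ(φ ⊞ 0_D) = Λ(φ)` (a direct summand acted on by zero does not contribute). [cite: HatcherAT2002, §2.C] -/
theorem lefschetzNumber_biprod_map_zero [∀ i, Module.Finite K (C.X i)] [∀ i, Module.Finite K (D.X i)]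
    (hC : (GradedObject.finrankSupport C.X).Finite) (hD : (GradedObject.finrankSupport D.X).Finite) :
    lefschetzNumber (biprod.map φ (0 : D ⟶ D)) = lefschetzNumber φ := by
  rw [lefschetzNumber_biprod_map φ 0 hC hD, lefschetzNumber_zero, add_zero]

end Biprod

end Literature.Algebra.Homology.Lefschetz
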